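import Mathlib

/-!
# Crux `GrenetZeon.TwoDimCoefficients` (stmt-ValiantsHypothesis-8062) / rung `DualUnipotentThreeHalves` (stmt-24318):
# the JORDAN GAUGE LEMMA (typed, basis-free) — part 1, linear algebra

The thin-numerator bound ✓ `rank_hess0_transl_trace_adjugate_mul_le_numerator_gauge` (`…ThinNumeratorGauge`) reads, for
affine `A`, `B` with `det A ≡ c ≠ 0`, every constant `G`, scalar `λ` and point `p`,
`rank Hess_p tr(adj A·B) ≤ 2·m·rank B'(p) + 2·rank coeff(B')`, `B' = B + (A·G − G·A) + λ·A`.  Its docstring leaves as a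
PAPER REMARK ("not typed; needs a nilpotent Jordan basis") the statement that makes the pointwise term small: at a point
where `A(p) = 1 + N_p`, `N_p` nilpotent, some `G` achieves `rank(B(p) + [A(p), G]) ≤ #`Jordan blocks of `N_p`.  This was
item R3″ of the exact remaining-lemma list of the 12th hand on the item (REQUESTS.md 2026-08-31T15:14:03Z).

This file TYPES that lemma, WITHOUT a Jordan basis and in a stronger form (pure linear algebra over a field `K`; the
plug-in to the Hessian bounds is part 2, `…DualUnipotentJordanGaugeHessian`):

* §1 `eq_zero_of_forall_trace_mul_eq_zero`, `eq_top_of_trace_orthogonal_eq_zero` — the trace pairing `tr(X·Y)` on square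
  matrices is non-degenerate, so a subspace of matrices with zero trace-orthogonal is everything (dual-space count).
* §2 `commute_of_trace_orthogonal` — `X ⊥ {A·G − G·A : G}` forces `X·A = A·X`;
  `mulVec_mem_of_trace_orthogonal` — `X ⊥ {Y : Y|_U = 0}` forces `range X ⊆ U`.
* §3 ★ `exists_add_comm_mulVec_eq_zero` — **abstract gauge lemma**: if the subspace `U` contains NO non-zero `A`-stable
  subspace, then for every `Y` there is `G` with `(Y + (A·G − G·A))|_U = 0`.  (Proof: a matrix `X` trace-orthogonal to
  both families commutes with `A` and has range in `U`; that range is `A`-stable, hence zero; so the two families span.)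
  `rank_add_finrank_le_card` — a matrix killing `U` has rank `≤ codim U`.
* §4 ★ `exists_add_comm_mulVec_eq_zero_of_isNilpotent` — **Jordan gauge lemma**: `N` nilpotent and `U ∩ ker N = 0` (ANY
  such `U`, e.g. any complement of `ker N`) ⟹ every `Y` is corrected by a commutator `N·G − G·N` to vanish on `U`;
  ★ `exists_rank_add_comm_le_card_of_isNilpotent` — hence `rank(Y + (N·G − G·N)) + rank N ≤ m` for some `G`, i.e.
  `rank(Y + [N, G]) ≤ dim ker N =` the number of Jordan blocks of `N`.  Over an algebraically closed field the same holds
  for an ARBITRARY `A` with `dim ker N` replaced by `dim Σ_μ Eig_μ(A)` = the total number of Jordan blocks of `A`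
  (★ `exists_rank_add_comm_le_finrank_iSup_eigenspace`, via `stable_eq_bot_of_no_eigenvector`).

HONEST FRAMING: helper lemmas for an ASIDE crux; closes no stub — `stub_dualUnipotent` (`DualUnipotentBound` ⟺ the crux),
the rung 24318, `stub_longMassSlowLawInv` and `VP ≠ VNP` are untouched.  No definitions, no named facts, no sorry.
-/

noncomputable section

-- single-conjunct layout `Summits/ValiantsHypothesis/ValiantsHypothesis`: the duplicated namespace component is mandated
set_option linter.dupNamespace false

namespace Summit.ValiantsHypothesis.ValiantsHypothesis.Theorems.GrenetZeon.JordanGauge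

open Matrix Module

/-! ### §1 The trace pairing on square matrices -/

section TracePairing

variable {K : Type*} [Field K] {ι : Type*} [Fintype ι] [DecidableEq ι]

/-- Non-degeneracy of the trace pairing: if `tr(X·Y) = 0` for every `Y`, then `X = 0`. [folklore] -/
theorem eq_zero_of_forall_trace_mul_eq_zero (X : Matrix ι ι K)
    (h : ∀ Y : Matrix ι ι K, (X * Y).trace = 0) : X = 0 := by
  ext i j
  have hij := h (Matrix.single j i 1)
  rw [Matrix.trace_mul_single] at hij
  simpa using hij

/-- Spanning criterion: a subspace `S` of square matrices whose trace-orthogonal is zero is the whole space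
(the map `X ↦ tr(X·-)|_S` into the dual of `S` is injective, so `dim S ≥ m²`). [folklore] -/
theorem eq_top_of_trace_orthogonal_eq_zero (S : Submodule K (Matrix ι ι K))
    (h : ∀ X : Matrix ι ι K, (∀ Y ∈ S, (X * Y).trace = 0) → X = 0) : S = ⊤ := by
  let τ : Matrix ι ι K →ₗ[K] Matrix ι ι K →ₗ[K] K :=
    (LinearMap.mul K (Matrix ι ι K)).compr₂ (Matrix.traceLinearMap ι K K)
  let φ : Matrix ι ι K →ₗ[K] Module.Dual K S := (τ.flip.domRestrict S).flip
  have hφ : Function.Injective φ := by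
    rw [← LinearMap.ker_eq_bot, LinearMap.ker_eq_bot']
    intro X hX
    refine h X fun Y hY => ?_
    have hXY := LinearMap.congr_fun hX ⟨Y, hY⟩
    simpa [φ, τ] using hXY
  have h1 : finrank K (Matrix ι ι K) ≤ finrank K S :=
    (LinearMap.finrank_le_finrank_of_injective hφ).trans (le_of_eq Subspace.dual_finrank_eq)
  exact Submodule.eq_top_of_finrank_eq (le_antisymm (Submodule.finrank_le S) h1)

end TracePairing

/-! ### §2 The two orthogonality computations -/

section Orthogonal

variable {K : Type*} [Field K] {ι : Type*} [Fintype ι] [DecidableEq ι]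

omit [DecidableEq ι] in
/-- `tr(X·(A·G − G·A)) = tr((X·A − A·X)·G)` (cyclicity of the trace). [folklore] -/
theorem trace_mul_comm_eq (X A G : Matrix ι ι K) :
    (X * (A * G - G * A)).trace = ((X * A - A * X) * G).trace := by
  simp only [Matrix.mul_sub, Matrix.sub_mul, Matrix.trace_sub, ← Matrix.mul_assoc]
  rw [Matrix.trace_mul_cycle X G A]

/-- If `X` is trace-orthogonal to every commutator `A·G − G·A`, then `X` commutes with `A`. [folklore] -/
theorem commute_of_trace_orthogonal (X A : Matrix ι ι K)
    (h : ∀ G : Matrix ι ι K, (X * (A * G - G * A)).trace = 0) : X * A = A * X := by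
  have h0 := eq_zero_of_forall_trace_mul_eq_zero (X * A - A * X)
    (fun G => by rw [← trace_mul_comm_eq]; exact h G)
  exact sub_eq_zero.mp h0

/-- If `X` is trace-orthogonal to every matrix `Y` vanishing on the subspace `U`, then the range of `X` lies in `U`
(test against the rank-one matrices `w ⊗ f`, `f` a functional killing `U`). [folklore] -/
theorem mulVec_mem_of_trace_orthogonal (X : Matrix ι ι K) (U : Submodule K (ι → K))
    (h : ∀ Y : Matrix ι ι K, (∀ u ∈ U, Y *ᵥ u = 0) → (X * Y).trace = 0) (w : ι → K) :
    X *ᵥ w ∈ U := by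
  by_contra hw
  obtain ⟨f, hf, hfU⟩ := U.exists_dual_map_eq_bot_of_notMem hw inferInstance
  -- coordinates of the functional `f`
  let b : ι → K := fun i => f (fun j => if i = j then 1 else 0)
  have hb : ∀ v : ι → K, f v = b ⬝ᵥ v := fun v => by
    rw [LinearMap.pi_apply_eq_sum_univ f v, dotProduct]
    exact Finset.sum_congr rfl fun i _ => by rw [smul_eq_mul, mul_comm]
  have hfU' : ∀ u ∈ U, f u = 0 := fun u hu => by
    have hu' : f u ∈ U.map f := Submodule.mem_map_of_mem hu
    rw [hfU] at hu'
    exact (Submodule.mem_bot K).mp hu'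
  -- the rank-one test matrix `w ⊗ b` vanishes on `U` but pairs non-trivially with `X`
  have hY : ∀ u ∈ U, vecMulVec w b *ᵥ u = 0 := fun u hu => by
    rw [Matrix.vecMulVec_mulVec, ← hb u, hfU' u hu, MulOpposite.op_zero, zero_smul]
  have htr := h (vecMulVec w b) hY
  rw [Matrix.mul_vecMulVec, Matrix.trace_vecMulVec, dotProduct_comm, ← hb] at htr
  exact hf htr

end Orthogonal

/-! ### §3 The abstract gauge lemma -/

section Abstract

variable {K : Type*} [Field K] {ι : Type*} [Fintype ι] [DecidableEq ι]

/-- ★ **Gauge lemma (abstract form).**  If the subspace `U` contains no non-zero `A`-stable subspace, then every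
matrix `Y` can be corrected by a commutator `A·G − G·A` so as to vanish on `U`.  Proof: the commutators and the
matrices vanishing on `U` together span all matrices, because a matrix trace-orthogonal to both commutes with `A`
and has its range inside `U`, and that range is `A`-stable. [folklore] -/
theorem exists_add_comm_mulVec_eq_zero (A : Matrix ι ι K) (U : Submodule K (ι → K))
    (hU : ∀ W : Submodule K (ι → K), W ≤ U → (∀ w ∈ W, A *ᵥ w ∈ W) → W = ⊥)
    (Y : Matrix ι ι K) :
    ∃ G : Matrix ι ι K, ∀ u ∈ U, (Y + (A * G - G * A)) *ᵥ u = 0 := by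
  let adA : Matrix ι ι K →ₗ[K] Matrix ι ι K := LinearMap.mulLeft K A - LinearMap.mulRight K A
  have hadA : ∀ G, adA G = A * G - G * A := fun G => rfl
  let WU : Submodule K (Matrix ι ι K) :=
    { carrier := {Y | ∀ u ∈ U, Y *ᵥ u = 0}
      add_mem' := fun {a b} ha hb u hu => by
        show (a + b) *ᵥ u = 0
        rw [Matrix.add_mulVec, ha u hu, hb u hu, add_zero]
      zero_mem' := fun u _ => Matrix.zero_mulVec u
      smul_mem' := fun c Y hY u hu => by
        show (c • Y) *ᵥ u = 0
        rw [Matrix.smul_mulVec, hY u hu, smul_zero] }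
  have htop : LinearMap.range adA ⊔ WU = ⊤ := by
    refine eq_top_of_trace_orthogonal_eq_zero _ fun X hX => ?_
    have hcomm : X * A = A * X := commute_of_trace_orthogonal X A fun G =>
      hX _ (Submodule.mem_sup_left (LinearMap.mem_range.mpr ⟨G, hadA G⟩))
    have hrange : ∀ w, X *ᵥ w ∈ U :=
      mulVec_mem_of_trace_orthogonal X U fun Y hY => hX _ (Submodule.mem_sup_right hY)
    have hW : LinearMap.range X.mulVecLin = ⊥ := by
      refine hU _ ?_ ?_
      · rintro _ ⟨w, rfl⟩
        exact hrange w
      · rintro _ ⟨w, rfl⟩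
        refine ⟨A *ᵥ w, ?_⟩
        simp only [Matrix.mulVecLin_apply]
        rw [Matrix.mulVec_mulVec, Matrix.mulVec_mulVec, hcomm]
    have hX0 : ∀ w, X *ᵥ w = 0 := fun w => by
      have hw : X *ᵥ w ∈ LinearMap.range X.mulVecLin := ⟨w, rfl⟩
      rw [hW] at hw
      exact (Submodule.mem_bot K).mp hw
    ext i j
    have hij := congr_fun (hX0 (Pi.single j 1)) i
    simpa [Matrix.mulVec, dotProduct, Pi.single_apply] using hij
  have hY : Y ∈ LinearMap.range adA ⊔ WU := by rw [htop]; exact Submodule.mem_top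
  obtain ⟨Cm, hCm, Z, hZ, hsum⟩ := Submodule.mem_sup.mp hY
  obtain ⟨G, rfl⟩ := LinearMap.mem_range.mp hCm
  refine ⟨-G, fun u hu => ?_⟩
  have hYZ : Y + (A * -G - -G * A) = Z := by
    rw [← hsum, hadA, Matrix.mul_neg, Matrix.neg_mul]
    abel
  rw [hYZ]
  exact hZ u hu

omit [DecidableEq ι] in
/-- If a matrix kills the subspace `U`, its rank is at most the codimension of `U`. [folklore] -/
theorem rank_add_finrank_le_card (M : Matrix ι ι K) (U : Submodule K (ι → K))
    (hM : ∀ u ∈ U, M *ᵥ u = 0) : M.rank + finrank K U ≤ Fintype.card ι := by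
  have hker : U ≤ LinearMap.ker M.mulVecLin := fun u hu => by
    rw [LinearMap.mem_ker, Matrix.mulVecLin_apply]
    exact hM u hu
  have h := LinearMap.finrank_range_add_finrank_ker M.mulVecLin
  rw [Module.finrank_fintype_fun_eq_card] at h
  unfold Matrix.rank
  calc finrank K (LinearMap.range M.mulVecLin) + finrank K U
      ≤ finrank K (LinearMap.range M.mulVecLin) + finrank K (LinearMap.ker M.mulVecLin) :=
        Nat.add_le_add_left (Submodule.finrank_mono hker) _
    _ = Fintype.card ι := h

end Abstract

/-! ### §4 The Jordan gauge lemma: nilpotent `N`, and arbitrary `A` over an algebraically closed field -/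

section Nilpotent

variable {K : Type*} [Field K] {ι : Type*} [Fintype ι] [DecidableEq ι]

/-- A non-zero vector in a subspace stable under a nilpotent matrix `N` has a non-zero iterate `N^i w` in the
subspace killed by `N` (the last non-zero iterate). [folklore] -/
theorem exists_mem_ker_of_stable {N : Matrix ι ι K} (hN : IsNilpotent N) {W : Submodule K (ι → K)}
    (hW : ∀ w ∈ W, N *ᵥ w ∈ W) {w : ι → K} (hw : w ∈ W) (hw0 : w ≠ 0) :
    ∃ v ∈ W, v ≠ 0 ∧ N *ᵥ v = 0 := by
  classical
  obtain ⟨k, hk⟩ := hN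
  have hiter : ∀ j : ℕ, (N ^ j) *ᵥ w ∈ W := by
    intro j
    induction j with
    | zero => simpa using hw
    | succ j ih =>
      rw [pow_succ', ← Matrix.mulVec_mulVec]
      exact hW _ ih
  have hex : ∃ j : ℕ, (N ^ j) *ᵥ w = 0 := ⟨k, by rw [hk, Matrix.zero_mulVec]⟩
  have hj : (N ^ Nat.find hex) *ᵥ w = 0 := Nat.find_spec hex
  have hj0 : Nat.find hex ≠ 0 := by
    intro h0
    apply hw0
    rw [h0, pow_zero, Matrix.one_mulVec] at hj
    exact hj
  obtain ⟨i, hi⟩ := Nat.exists_eq_add_one_of_ne_zero hj0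
  refine ⟨(N ^ i) *ᵥ w, hiter i, Nat.find_min hex (by omega), ?_⟩
  rw [Matrix.mulVec_mulVec, ← pow_succ', ← hi]
  exact hj

/-- For a nilpotent `N`, a subspace meeting `ker N` trivially contains no non-zero `N`-stable subspace. [folklore] -/
theorem stable_eq_bot_of_isNilpotent {N : Matrix ι ι K} (hN : IsNilpotent N) (U : Submodule K (ι → K))
    (hUK : ∀ u ∈ U, N *ᵥ u = 0 → u = 0) (W : Submodule K (ι → K)) (hWU : W ≤ U)
    (hW : ∀ w ∈ W, N *ᵥ w ∈ W) : W = ⊥ := by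
  rw [Submodule.eq_bot_iff]
  intro w hw
  by_contra hw0
  obtain ⟨v, hvW, hv0, hNv⟩ := exists_mem_ker_of_stable hN hW hw hw0
  exact hv0 (hUK v (hWU hvW) hNv)

/-- ★ **Jordan gauge lemma (vanishing form).**  `N` nilpotent, `U` a subspace with `U ∩ ker N = 0` (e.g. any
complement of `ker N`): every matrix `Y` is corrected by a commutator `N·G − G·N` to vanish on `U`.  (In a Jordan
basis with `U` the span of the non-socle chain vectors this is the classical statement that `Y` is gauge-equivalent
to a matrix supported on the socle columns; no Jordan basis is used here.) [folklore] -/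
theorem exists_add_comm_mulVec_eq_zero_of_isNilpotent {N : Matrix ι ι K} (hN : IsNilpotent N)
    (U : Submodule K (ι → K)) (hUK : ∀ u ∈ U, N *ᵥ u = 0 → u = 0) (Y : Matrix ι ι K) :
    ∃ G : Matrix ι ι K, ∀ u ∈ U, (Y + (N * G - G * N)) *ᵥ u = 0 :=
  exists_add_comm_mulVec_eq_zero N U (stable_eq_bot_of_isNilpotent hN U hUK) Y

/-- ★ **Jordan gauge lemma (rank form).**  For a nilpotent `N` and every `Y` there is `G` with
`rank(Y + (N·G − G·N)) + rank N ≤ m`, i.e. `rank(Y + [N, G]) ≤ dim ker N =` the number of Jordan blocks of `N`.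
[folklore] -/
theorem exists_rank_add_comm_le_card_of_isNilpotent {N : Matrix ι ι K} (hN : IsNilpotent N)
    (Y : Matrix ι ι K) :
    ∃ G : Matrix ι ι K, (Y + (N * G - G * N)).rank + N.rank ≤ Fintype.card ι := by
  obtain ⟨U, hU⟩ := Submodule.exists_isCompl (LinearMap.ker N.mulVecLin)
  have hUK : ∀ u ∈ U, N *ᵥ u = 0 → u = 0 := fun u hu h0 => by
    have hu' : u ∈ LinearMap.ker N.mulVecLin ⊓ U :=
      Submodule.mem_inf.mpr ⟨LinearMap.mem_ker.mpr (by rw [Matrix.mulVecLin_apply]; exact h0), hu⟩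
    rw [hU.inf_eq_bot] at hu'
    exact (Submodule.mem_bot K).mp hu'
  obtain ⟨G, hG⟩ := exists_add_comm_mulVec_eq_zero_of_isNilpotent hN U hUK Y
  refine ⟨G, ?_⟩
  have h1 := rank_add_finrank_le_card _ U hG
  have h2 : finrank K (LinearMap.ker N.mulVecLin) + finrank K U = Fintype.card ι := by
    rw [← Submodule.finrank_sup_add_finrank_inf_eq, hU.sup_eq_top, hU.inf_eq_bot, finrank_top, finrank_bot,
      add_zero, Module.finrank_fintype_fun_eq_card]
  have h3 := LinearMap.finrank_range_add_finrank_ker N.mulVecLin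
  rw [Module.finrank_fintype_fun_eq_card] at h3
  unfold Matrix.rank at h1 ⊢
  omega

end Nilpotent

section Eigen

variable {K : Type*} [Field K] [IsAlgClosed K] {ι : Type*} [Fintype ι] [DecidableEq ι]

omit [DecidableEq ι] in
/-- Over an algebraically closed field, a subspace containing no eigenvector of `A` contains no non-zero `A`-stable
subspace. [folklore] -/
theorem stable_eq_bot_of_no_eigenvector (A : Matrix ι ι K) (U : Submodule K (ι → K))
    (hUE : ∀ u ∈ U, ∀ μ : K, A *ᵥ u = μ • u → u = 0) (W : Submodule K (ι → K)) (hWU : W ≤ U)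
    (hW : ∀ w ∈ W, A *ᵥ w ∈ W) : W = ⊥ := by
  by_contra hne
  have hW' : ∀ w ∈ W, A.mulVecLin w ∈ W := fun w hw => by
    rw [Matrix.mulVecLin_apply]; exact hW w hw
  let f : Module.End K W := A.mulVecLin.restrict hW'
  haveI : Nontrivial W := Submodule.nontrivial_iff_ne_bot.mpr hne
  obtain ⟨μ, hμ⟩ := Module.End.exists_eigenvalue f
  obtain ⟨v, hv⟩ := hμ.exists_hasEigenvector
  have hv1 : f v = μ • v := hv.apply_eq_smul
  have hval : A *ᵥ (v : ι → K) = μ • (v : ι → K) := by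
    have h := congrArg Subtype.val hv1
    simpa [f, LinearMap.restrict_apply] using h
  exact hv.2 (Subtype.ext (hUE v (hWU v.2) μ hval))

/-- ★ **Gauge lemma for an arbitrary matrix (algebraically closed field).**  For every `A`, `Y` there is `G` with
`rank(Y + (A·G − G·A)) ≤ dim Σ_μ Eig_μ(A)` (the total number of Jordan blocks of `A`). [folklore] -/
theorem exists_rank_add_comm_le_finrank_iSup_eigenspace (A Y : Matrix ι ι K) :
    ∃ G : Matrix ι ι K, (Y + (A * G - G * A)).rank ≤
      finrank K (⨆ μ : K, Module.End.eigenspace A.mulVecLin μ : Submodule K (ι → K)) := by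
  set E : Submodule K (ι → K) := ⨆ μ : K, Module.End.eigenspace A.mulVecLin μ with hE
  obtain ⟨U, hU⟩ := Submodule.exists_isCompl E
  have hUE : ∀ u ∈ U, ∀ μ : K, A *ᵥ u = μ • u → u = 0 := fun u hu μ hμ => by
    have huE : u ∈ E := by
      have h1 : u ∈ Module.End.eigenspace A.mulVecLin μ := by
        rw [Module.End.mem_eigenspace_iff, Matrix.mulVecLin_apply]; exact hμ
      exact (le_iSup (fun μ : K => Module.End.eigenspace A.mulVecLin μ) μ) h1
    have hu' : u ∈ E ⊓ U := Submodule.mem_inf.mpr ⟨huE, hu⟩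
    rw [hU.inf_eq_bot] at hu'
    exact (Submodule.mem_bot K).mp hu'
  obtain ⟨G, hG⟩ := exists_add_comm_mulVec_eq_zero A U (stable_eq_bot_of_no_eigenvector A U hUE) Y
  refine ⟨G, ?_⟩
  have h1 := rank_add_finrank_le_card _ U hG
  have h2 : finrank K E + finrank K U = Fintype.card ι := by
    rw [← Submodule.finrank_sup_add_finrank_inf_eq, hU.sup_eq_top, hU.inf_eq_bot, finrank_top, finrank_bot,
      add_zero, Module.finrank_fintype_fun_eq_card]
  omega

end Eigen

end Summit.ValiantsHypothesis.ValiantsHypothesis.Theorems.GrenetZeon.JordanGauge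

end
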